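import Summits.Ventures.DiscreteObjects.Hadamard.ConferenceGraph333FixedSubgraph

/-!
# The orbit row identity of a prime-order automorphism of srg(333,166,82,83), and the arithmetic endgame of the
# `ℤ/41 ⋊ ℤ/5` exclusion (kernel)

Framing: lottery ticket; floor = certified bounds/negative ranges.  Cell pub-namedobj (venture DiscreteObjects),
target (H) = `H(668)`, hadamard gen 33.  Tools for `ConferenceGraph333NoFrobenius41` (no element of order `5` normalises an
element of order `41`):
* **`seidel_orbit_row_identity`** (any prime `p`, any automorphism `σ` with `σ^p = 1`, any moved vertex `u`) — with the
  Seidel entries `S_{xy} = 1 − [x=y] − 2A_{xy}` (`S² = 333·I − J`) and `T(y) = Σ_{k<p} S_{u,σᵏy}` (the sum of row `u` over the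
  `⟨σ⟩`-orbit of `y`, resp. `p·S_{uy}` for a fixed `y`):  **`Σ_y S_{uy} T(y) = 333 − p`**.  Grouped by orbits this is the ROW
  IDENTITY OF THE ORBIT MATRIX `Σ_C T_C² = 333 − p − p·#Fix σ` (fixed vertices contribute `p` each; `T_C = |C| − [u ∈ C] −
  2|N(u) ∩ C|` is odd for `C ≠ orb(u)` when `p` is odd) — the exact form of the inequality behind
  `aut_prime_orbit_valency_bound` (gen 30).  Instances: `p = 83`: `(82 − 2v)² + Σ_{3} T_C² = 167` (so the within-orbit valency
  `v ∈ {36,…,46}`; E2 gen 30 orbit matrices: `4 + 1 + 81 + 81 = 167`); `p = 41`: `(40 − 2v)² + Σ_{7} T_C² = 87` (`v ∈ {16,…,24}`,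
  E2: `138` admissible rows); `p = 37`: `(36 − 2v)² + Σ_{8} T_C² = 296`.
* **`frob41_endgame`** — the arithmetic core of the `ℤ/41 ⋊ ℤ/5` exclusion: seven integers `x_j = 20 + a_j + 5 z_j`
  (`a_j ∈ {0,1}`) with `Σ (41 − 2x_j)² = 87`, `Σ x_j = 146 − c`, `Σ a_j = 6 − c` do not exist
  (`Σ z = 0`, `Σ (5z² − z + 2az) = 4 ⇒ Σ z² ≤ 1`, parity `Σ z² ≡ Σ z`).
E2 (exact, pure python): pub-namedobj-hadamard-g33/code/check_orbit_row_identity.py (the identity on the Paley graphs P(13),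
P(29), P(37), P(41), P(61) with multiplicative automorphisms), code/check_frobenius41x5_endgame.py (0 solutions).
WORDS: structure of a HYPOTHETICAL object; method in print: orbit matrices (Behbahani–Lam, Discrete Math. 311 (2011) 132–144);
instance and proofs ours (PROVISIONAL).  No `sorry`, no new definitions.
-/

namespace Summit.Ventures.DiscreteObjects.Hadamard

open Finset

section orbitRowIdentity
variable {V : Type*} [Fintype V] [DecidableEq V]

/-- rotating a sum over `range p` of a `p`-periodic sequence -/
theorem sum_range_shift_periodic (g : ℕ → ℤ) (p : ℕ) (hper : g p = g 0) :
    ∑ k ∈ Finset.range p, g (k + 1) = ∑ k ∈ Finset.range p, g k := by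
  have h1 := Finset.sum_range_succ' g p
  have h2 := Finset.sum_range_succ g p
  linarith

/-- **Orbit row identity.**  For an automorphism `σ` of an `srg(333,166,82,83)` with `σ^p = 1` (`p` prime) and a vertex `u`
moved by `σ`:  `Σ_y S_{uy} · (Σ_{k<p} S_{u,σᵏy}) = 333 − p`, `S_{xy} = 1 − [x=y] − 2A_{xy}`. -/
theorem seidel_orbit_row_identity (hV : Fintype.card V = 333) (A : Matrix V V ℤ)
    (h01 : ∀ x y, A x y = 0 ∨ A x y = 1) (hsymm : ∀ x y, A y x = A x y) (hdiag : ∀ x, A x x = 0)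
    (hk : ∀ x, ∑ y, A x y = 166) (hsrg : ∀ x y, ∑ z, A x z * A z y = 83 * (1 + (if x = y then 1 else 0)) - A x y)
    {p : ℕ} (hp : p.Prime) (σ : Equiv.Perm V) (hσ : σ ^ p = 1) (hA : ∀ x y, A (σ x) (σ y) = A x y)
    {u : V} (hu : σ u ≠ u) :
    ∑ y, (1 - (if u = y then (1 : ℤ) else 0) - 2 * A u y) *
        ∑ k ∈ Finset.range p, (1 - (if u = (σ ^ k) y then (1 : ℤ) else 0) - 2 * A u ((σ ^ k) y)) = 333 - p := by
  classical
  obtain ⟨-, -, hSs, -, hSS⟩ := seidel_identities_of_conferenceGraph A h01 hsymm hdiag 83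
    (by rw [hV]; norm_num) (fun x => by rw [hk x]; norm_num) hsrg
  set S : V → V → ℤ := fun x y => 1 - (if x = y then 1 else 0) - 2 * A x y with hS_def
  have hSS' : ∀ x y, ∑ z, S x z * S z y = 333 * (if x = y then 1 else 0) - 1 := fun x y => by
    rw [hSS x y, hV]; norm_num
  have hSσk : ∀ (k : ℕ) x y, S ((σ ^ k) x) ((σ ^ k) y) = S x y := fun k x y => by
    simp only [hS_def, adj_pow_invariant A σ hA k, (σ ^ k).injective.eq_iff]
  have key : ∀ k : ℕ, ∑ y, S u y * S u ((σ ^ k) y) = 333 * (if (σ ^ k) u = u then 1 else 0) - 1 := by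
    intro k
    have e : ∀ y, S u ((σ ^ k) y) = S y ((σ ^ k).symm u) := fun y =>
      calc S u ((σ ^ k) y) = S ((σ ^ k) ((σ ^ k).symm u)) ((σ ^ k) y) := by rw [Equiv.apply_symm_apply]
        _ = S ((σ ^ k).symm u) y := hSσk k _ _
        _ = S y ((σ ^ k).symm u) := (hSs _ _).symm
    rw [Finset.sum_congr rfl (fun y _ => by rw [e y]), hSS' u ((σ ^ k).symm u)]
    by_cases hfix : (σ ^ k) u = u
    · rw [if_pos hfix, if_pos ((σ ^ k).eq_symm_apply.mpr hfix)]
    · rw [if_neg hfix, if_neg (fun h => hfix ((σ ^ k).eq_symm_apply.mp h))]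
  have hinj := orbP_injOn σ hp hσ u hu
  calc ∑ y, S u y * ∑ k ∈ Finset.range p, S u ((σ ^ k) y)
      = ∑ y, ∑ k ∈ Finset.range p, S u y * S u ((σ ^ k) y) := by
        refine Finset.sum_congr rfl fun y _ => ?_
        rw [Finset.mul_sum]
    _ = ∑ k ∈ Finset.range p, ∑ y, S u y * S u ((σ ^ k) y) := Finset.sum_comm
    _ = ∑ k ∈ Finset.range p, ((333 : ℤ) * (if (σ ^ k) u = u then 1 else 0) - 1) :=
        Finset.sum_congr rfl fun k _ => key k
    _ = 333 - p := by
        rw [Finset.sum_sub_distrib, Finset.sum_const, Finset.card_range, ← Finset.mul_sum, Finset.sum_boole]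
        have hfilt : (Finset.range p).filter (fun k => (σ ^ k) u = u) = {0} := by
          ext k
          simp only [Finset.mem_filter, Finset.mem_range, Finset.mem_singleton]
          constructor
          · rintro ⟨hkp, hfix⟩
            exact hinj (Finset.mem_coe.mpr (Finset.mem_range.mpr hkp))
              (Finset.mem_coe.mpr (Finset.mem_range.mpr hp.pos)) (by simpa using hfix)
          · rintro rfl
            exact ⟨hp.pos, by simp⟩
        rw [hfilt, Finset.card_singleton]
        simp

/-- **Arithmetic endgame** of the `ℤ/41 ⋊ ℤ/5` exclusion: seven integers `x_j = 20 + a_j + 5 z_j`, `a_j ∈ {0,1}`, with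
`Σ (41 − 2 x_j)² = 87`, `Σ x_j = 146 − c` and `Σ a_j = 6 − c` do not exist. -/
theorem frob41_endgame {ι : Type*} (s : Finset ι) (hs : s.card = 7) (x a z : ι → ℤ) (c : ℤ)
    (ha : ∀ i ∈ s, a i = 0 ∨ a i = 1) (hx : ∀ i ∈ s, x i = 20 + a i + 5 * z i)
    (hsq : ∑ i ∈ s, (41 - 2 * x i) ^ 2 = 87) (hsum : ∑ i ∈ s, x i = 146 - c)
    (hasum : ∑ i ∈ s, a i = 6 - c) : False := by
  -- Σ z = 0
  have hz0 : ∑ i ∈ s, z i = 0 := by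
    have e : ∑ i ∈ s, x i = ∑ i ∈ s, (20 + a i + 5 * z i) := Finset.sum_congr rfl hx
    rw [Finset.sum_add_distrib, Finset.sum_add_distrib, Finset.sum_const, hs, ← Finset.mul_sum, hsum, hasum,
      nsmul_eq_mul, Nat.cast_ofNat] at e
    omega
  -- Σ (5 z² − z + 2 a z) = 4
  have hq : ∑ i ∈ s, (5 * z i ^ 2 - z i + 2 * a i * z i) = 4 := by
    have e : ∀ i ∈ s, (41 - 2 * x i) ^ 2 = 1 + 20 * (5 * z i ^ 2 - z i + 2 * a i * z i) := by
      intro i hi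
      have ha2 : a i * a i = a i := by rcases ha i hi with h | h <;> simp [h]
      rw [hx i hi]
      linear_combination 4 * ha2
    rw [Finset.sum_congr rfl e, Finset.sum_add_distrib, Finset.sum_const, hs, ← Finset.mul_sum, nsmul_eq_mul,
      Nat.cast_ofNat] at hsq
    omega
  -- Σ z² ≤ 1
  have hz2 : ∑ i ∈ s, z i ^ 2 ≤ 1 := by
    have e : ∀ i ∈ s, 3 * z i ^ 2 ≤ 5 * z i ^ 2 - z i + 2 * a i * z i := by
      intro i hi
      rcases le_or_gt 0 (z i) with hz | hz
      · rcases ha i hi with h | h <;> rw [h] <;> nlinarith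
      · rcases ha i hi with h | h <;> rw [h] <;> nlinarith
    have h := Finset.sum_le_sum e
    rw [← Finset.mul_sum, hq] at h
    omega
  -- parity: Σ z² ≡ Σ z = 0 (mod 2), so Σ z² = 0 and every z vanishes
  have hpar : (2 : ℤ) ∣ ∑ i ∈ s, (z i ^ 2 - z i) := Finset.dvd_sum fun i _ => by
    obtain ⟨r, hr⟩ := Int.even_mul_succ_self (z i - 1)
    exact ⟨r, by linear_combination hr⟩
  rw [Finset.sum_sub_distrib, hz0, sub_zero] at hpar
  have h0 : 0 ≤ ∑ i ∈ s, z i ^ 2 := Finset.sum_nonneg fun i _ => sq_nonneg _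
  have hzz : ∑ i ∈ s, z i ^ 2 = 0 := by omega
  have hzi : ∀ i ∈ s, z i = 0 := fun i hi =>
    (pow_eq_zero_iff (n := 2) (by norm_num)).mp ((Finset.sum_eq_zero_iff_of_nonneg fun j _ => sq_nonneg (z j)).mp hzz i hi)
  have h4 : ∑ i ∈ s, (5 * z i ^ 2 - z i + 2 * a i * z i) = 0 :=
    Finset.sum_eq_zero fun i hi => by rw [hzi i hi]; ring
  omega

end orbitRowIdentity

end Summit.Ventures.DiscreteObjects.Hadamard
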